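/-
rh-split cell (screw), width seat 2 on line L22/L23 (routes ScrewQuarticNodes / ScrewExcursionDoor,
desk rh-idea-9), 2026-08-27.  The WIDTH LAW of negative excursions of Suzuki's screw function
(prime-side semiconcavity in usable form) and what one dip contributes to the L23 excursion budget.
RH-free real analysis about `Ψ`; RH is not proved by this and nothing here bears on the truth of RH.
-/
import Summits.RiemannHypothesis.RiemannHypothesis.Theorems.ScrewQuarticNodesSparseNodeDoor
import HarnessLib

/-!
# Width law for negative excursions of `Ψ` (supports item stmt-RiemannHypothesis-22185)

`Ψ = zetaScrew` (Suzuki2023 (1.1)).  Route ScrewQuarticNodes records the lever behind its door as a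
NUMBER: «an excursion of depth `2K` at `t₀` keeps `Ψ ≤ -K` on a one-sided window of length
`√(2K/(e^{(t₀+1)/2}+1))`»; route ScrewExcursionDoor notes that «the width law of excursions lives on
the sibling line».  This file states it once, reusably:

* `zetaScrew_excursion_window` — for `t₀ ≥ 1`, `D > 0` with `2D ≤ M := e^{(t₀+1)/2} + 1`: if
  `Ψ(t₀) ≤ -2D` then `Ψ ≤ -D` on `[t₀, t₀ + δ]` or on `[t₀ - δ, t₀]`, `δ = √(2D/M)` (one-sided
  Taylor bound `zetaScrew_le_taylor`: `Ψ(t) ≤ Ψ(t₀) + p(t - t₀) + ½M(t - t₀)²`, go right if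
  `p ≤ 0`, left if `p > 0`);
* `volume_excursion_ge` — hence the excursion set `{Ψ ≤ -D}` has Lebesgue measure `≥ √(2D/M)`
  inside `[t₀ - 1, t₀ + 1]`;
* `deficit_integral_ge` — and for `θ, σ₀ ≥ 0` the `e^{-σ₀t}`-weighted `θ`-deficit
  `(−Ψ − e^{θt})⁺` of route ScrewExcursionDoor (the integrand of `ExcursionResidual`, stmt-22185)
  collects at least `√(2D/M) · (D − e^{θ(t₀+1)}) · e^{−σ₀(t₀+1)}` on `[t₀ - 1, t₀ + 1]` from that
  one dip — the quantitative bridge between the L22 width law and the L23 Laplace-mass grading.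

RH is not proved by this; nothing here bears on the truth of RH.
-/

-- D-0017: `Summit.RiemannHypothesis.RiemannHypothesis.…` duplicates the namespace BY DESIGN (single-problem summit).
set_option linter.dupNamespace false

noncomputable section

open Real Set MeasureTheory

namespace Summit.RiemannHypothesis.RiemannHypothesis.Theorems.ScrewQuarticNodesExcursionWidth

open Literature.NumberTheory.LFunctions
open Summit.RiemannHypothesis.RiemannHypothesis.Theorems.ScrewQuarticNodesSparseNodeDoor
  (zetaScrew_le_taylor)

/-- **Width law (one-sided excursion window).**  Let `t₀ ≥ 1`, `D > 0`, `M = e^{(t₀+1)/2} + 1` and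
`2D ≤ M`.  If `Ψ(t₀) ≤ -2D`, then with `δ = √(2D/M) ≤ 1` either `Ψ ≤ -D` on `[t₀, t₀ + δ]` or
`Ψ ≤ -D` on `[t₀ - δ, t₀]`.  (Semiconcavity: `Ψ(t) ≤ Ψ(t₀) + p(t-t₀) + ½M(t-t₀)²` on
`[t₀-1, t₀+1]`; on the side where `p(t - t₀) ≤ 0` the quadratic term is at most `½Mδ² = D`.) -/
theorem zetaScrew_excursion_window {t₀ D : ℝ} (ht₀ : 1 ≤ t₀) (hD : 0 < D)
    (hDM : 2 * D ≤ Real.exp ((t₀ + 1) / 2) + 1) (hΨ : zetaScrew t₀ ≤ -(2 * D)) :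
    (∀ t ∈ Icc t₀ (t₀ + Real.sqrt (2 * D / (Real.exp ((t₀ + 1) / 2) + 1))), zetaScrew t ≤ -D) ∨
    (∀ t ∈ Icc (t₀ - Real.sqrt (2 * D / (Real.exp ((t₀ + 1) / 2) + 1))) t₀, zetaScrew t ≤ -D) := by
  set M : ℝ := Real.exp ((t₀ + 1) / 2) + 1 with hM
  have hMpos : 0 < M := by positivity
  have hq : 0 < 2 * D / M := div_pos (by linarith) hMpos
  have hq1 : 2 * D / M ≤ 1 := by rwa [div_le_one hMpos]
  set δ : ℝ := Real.sqrt (2 * D / M) with hδ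
  have hδ1 : δ ≤ 1 := by
    rw [hδ, ← Real.sqrt_one]
    exact Real.sqrt_le_sqrt hq1
  have hδsq : δ ^ 2 = 2 * D / M := Real.sq_sqrt hq.le
  have hquad : ∀ t : ℝ, (t - t₀) ^ 2 ≤ δ ^ 2 → M / 2 * (t - t₀) ^ 2 ≤ D := by
    intro t ht
    calc M / 2 * (t - t₀) ^ 2 ≤ M / 2 * δ ^ 2 := by gcongr
      _ = D := by rw [hδsq]; field_simp
  obtain ⟨p, hp⟩ := zetaScrew_le_taylor ht₀
  rcases le_or_gt p 0 with hp0 | hp0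
  · refine Or.inl fun t ht => ?_
    have hT := hp t ⟨by linarith [ht.1], by linarith [ht.2]⟩
    have hsq : (t - t₀) ^ 2 ≤ δ ^ 2 :=
      pow_le_pow_left₀ (by linarith [ht.1]) (by linarith [ht.2]) 2
    have hlin : p * (t - t₀) ≤ 0 := mul_nonpos_of_nonpos_of_nonneg hp0 (by linarith [ht.1])
    have := hquad t hsq
    linarith
  · refine Or.inr fun t ht => ?_
    have hT := hp t ⟨by linarith [ht.1], by linarith [ht.2]⟩
    have hsq : (t - t₀) ^ 2 ≤ δ ^ 2 := by
      rw [← neg_sq, neg_sub]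
      exact pow_le_pow_left₀ (by linarith [ht.2]) (by linarith [ht.1]) 2
    have hlin : p * (t - t₀) ≤ 0 := mul_nonpos_of_nonneg_of_nonpos hp0.le (by linarith [ht.2])
    have := hquad t hsq
    linarith

/-- **Measure form of the width law.**  Under the hypotheses of `zetaScrew_excursion_window`, the
excursion set `{t : Ψ(t) ≤ -D}` has Lebesgue measure at least `√(2D/(e^{(t₀+1)/2}+1))` inside the
window `[t₀ - 1, t₀ + 1]`. -/
theorem volume_excursion_ge {t₀ D : ℝ} (ht₀ : 1 ≤ t₀) (hD : 0 < D)
    (hDM : 2 * D ≤ Real.exp ((t₀ + 1) / 2) + 1) (hΨ : zetaScrew t₀ ≤ -(2 * D)) :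
    ENNReal.ofReal (Real.sqrt (2 * D / (Real.exp ((t₀ + 1) / 2) + 1))) ≤
      volume ({t : ℝ | zetaScrew t ≤ -D} ∩ Icc (t₀ - 1) (t₀ + 1)) := by
  set δ : ℝ := Real.sqrt (2 * D / (Real.exp ((t₀ + 1) / 2) + 1)) with hδ
  have hMpos : 0 < Real.exp ((t₀ + 1) / 2) + 1 := by positivity
  have hδ1 : δ ≤ 1 := by
    have h := Real.sqrt_le_sqrt ((div_le_one hMpos).2 hDM)
    rwa [Real.sqrt_one] at h
  rcases zetaScrew_excursion_window ht₀ hD hDM hΨ with h | h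
  · calc ENNReal.ofReal δ = volume (Icc t₀ (t₀ + δ)) := by
          rw [Real.volume_Icc]; congr 1; ring
      _ ≤ volume ({t : ℝ | zetaScrew t ≤ -D} ∩ Icc (t₀ - 1) (t₀ + 1)) := by
          refine measure_mono fun t ht => ⟨h t ht, ?_, ?_⟩
          · linarith [ht.1]
          · linarith [ht.2]
  · calc ENNReal.ofReal δ = volume (Icc (t₀ - δ) t₀) := by
          rw [Real.volume_Icc]; congr 1; ring
      _ ≤ volume ({t : ℝ | zetaScrew t ≤ -D} ∩ Icc (t₀ - 1) (t₀ + 1)) := by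
          refine measure_mono fun t ht => ⟨h t ht, ?_, ?_⟩
          · linarith [ht.1]
          · linarith [ht.2]

/-- The weighted `θ`-deficit of route ScrewExcursionDoor is continuous (hence locally integrable). -/
theorem continuous_deficit (θ σ₀ : ℝ) :
    Continuous (fun t : ℝ => max (-zetaScrew t - Real.exp (θ * t)) 0 * Real.exp (-(σ₀ * t))) :=
  ((continuous_zetaScrew.neg.sub (Real.continuous_exp.comp (continuous_const.mul continuous_id))).max
    continuous_const).mul (Real.continuous_exp.comp (continuous_const.mul continuous_id).neg)

/-- **One dip's contribution to the L23 excursion budget.**  Let `θ, σ₀ ≥ 0`, `t₀ ≥ 1`, `D > 0`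
with `2D ≤ e^{(t₀+1)/2} + 1` and `e^{θ(t₀+1)} ≤ D`.  If `Ψ(t₀) ≤ -2D`, then the
`e^{-σ₀t}`-weighted `θ`-deficit `(−Ψ(t) − e^{θt})⁺ e^{−σ₀t}` (the integrand of
`Theses.ScrewExcursionDoor.ExcursionResidual`) has integral over `[t₀ - 1, t₀ + 1]` at least
`√(2D/(e^{(t₀+1)/2}+1)) · (D − e^{θ(t₀+1)}) · e^{−σ₀(t₀+1)}`: on the excursion window of the width
law, `−Ψ − e^{θt} ≥ D − e^{θ(t₀+1)}` and `e^{−σ₀t} ≥ e^{−σ₀(t₀+1)}`. -/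
theorem deficit_integral_ge {t₀ D θ σ₀ : ℝ} (ht₀ : 1 ≤ t₀) (hD : 0 < D) (hθ : 0 ≤ θ)
    (hσ₀ : 0 ≤ σ₀) (hDM : 2 * D ≤ Real.exp ((t₀ + 1) / 2) + 1)
    (hθD : Real.exp (θ * (t₀ + 1)) ≤ D) (hΨ : zetaScrew t₀ ≤ -(2 * D)) :
    Real.sqrt (2 * D / (Real.exp ((t₀ + 1) / 2) + 1)) * (D - Real.exp (θ * (t₀ + 1)))
        * Real.exp (-(σ₀ * (t₀ + 1))) ≤
      ∫ t in Icc (t₀ - 1) (t₀ + 1),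
        max (-zetaScrew t - Real.exp (θ * t)) 0 * Real.exp (-(σ₀ * t)) := by
  set f : ℝ → ℝ := fun t => max (-zetaScrew t - Real.exp (θ * t)) 0 * Real.exp (-(σ₀ * t))
    with hf
  set c : ℝ := (D - Real.exp (θ * (t₀ + 1))) * Real.exp (-(σ₀ * (t₀ + 1))) with hc
  set δ : ℝ := Real.sqrt (2 * D / (Real.exp ((t₀ + 1) / 2) + 1)) with hδ
  have hMpos : 0 < Real.exp ((t₀ + 1) / 2) + 1 := by positivity
  have hδ0 : 0 ≤ δ := Real.sqrt_nonneg _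
  have hδ1 : δ ≤ 1 := by
    have h := Real.sqrt_le_sqrt ((div_le_one hMpos).2 hDM)
    rwa [Real.sqrt_one] at h
  have hc0 : 0 ≤ c := by
    have : 0 ≤ D - Real.exp (θ * (t₀ + 1)) := by linarith
    positivity
  have hf0 : ∀ t, 0 ≤ f t := fun t => by
    simp only [hf]; positivity
  have hfi : IntegrableOn f (Icc (t₀ - 1) (t₀ + 1)) :=
    (continuous_deficit θ σ₀).integrableOn_Icc
  -- on a window `I ⊆ [t₀-1, t₀+1]` of length `δ` where `Ψ ≤ -D`, `f ≥ c`
  have hfc : ∀ t ∈ Icc (t₀ - 1) (t₀ + 1), zetaScrew t ≤ -D → c ≤ f t := by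
    intro t ht hΨt
    have h1 : Real.exp (θ * t) ≤ Real.exp (θ * (t₀ + 1)) :=
      Real.exp_le_exp.2 (mul_le_mul_of_nonneg_left ht.2 hθ)
    have h2 : D - Real.exp (θ * (t₀ + 1)) ≤ max (-zetaScrew t - Real.exp (θ * t)) 0 :=
      le_trans (by linarith) (le_max_left _ _)
    have h3 : Real.exp (-(σ₀ * (t₀ + 1))) ≤ Real.exp (-(σ₀ * t)) :=
      Real.exp_le_exp.2 (by nlinarith [ht.2])
    have h4 : 0 ≤ D - Real.exp (θ * (t₀ + 1)) := by linarith
    calc c = (D - Real.exp (θ * (t₀ + 1))) * Real.exp (-(σ₀ * (t₀ + 1))) := rfl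
      _ ≤ max (-zetaScrew t - Real.exp (θ * t)) 0 * Real.exp (-(σ₀ * t)) := by
          gcongr
  -- integrate over the window
  have key : ∀ a b : ℝ, b - a = δ → Icc a b ⊆ Icc (t₀ - 1) (t₀ + 1) →
      (∀ t ∈ Icc a b, zetaScrew t ≤ -D) → δ * c ≤ ∫ t in Icc (t₀ - 1) (t₀ + 1), f t := by
    intro a b hab hsub hwin
    have hIc : ∫ _ in Icc a b, c = δ * c := by
      rw [setIntegral_const, Real.volume_real_Icc_of_le (by linarith), hab, smul_eq_mul]
    calc δ * c = ∫ _ in Icc a b, c := hIc.symm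
      _ ≤ ∫ t in Icc a b, f t := by
          refine setIntegral_mono_on (integrableOn_const (by simp [Real.volume_Icc]))
            (hfi.mono_set hsub) measurableSet_Icc fun t ht => hfc t (hsub ht) (hwin t ht)
      _ ≤ ∫ t in Icc (t₀ - 1) (t₀ + 1), f t :=
          setIntegral_mono_set hfi (Filter.Eventually.of_forall hf0) (ae_of_all _ hsub)
  have hgoal : δ * (D - Real.exp (θ * (t₀ + 1))) * Real.exp (-(σ₀ * (t₀ + 1))) = δ * c := by
    rw [hc]; ring
  rw [hgoal]
  rcases zetaScrew_excursion_window ht₀ hD hDM hΨ with h | h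
  · exact key t₀ (t₀ + δ) (by ring) (fun t ht => ⟨by linarith [ht.1], by linarith [ht.2]⟩) h
  · exact key (t₀ - δ) t₀ (by ring) (fun t ht => ⟨by linarith [ht.1], by linarith [ht.2]⟩) h

end Summit.RiemannHypothesis.RiemannHypothesis.Theorems.ScrewQuarticNodesExcursionWidth

end
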